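import Literature.NumberTheory.GaloisRepresentations.PadicAlgClFiniteSubextensionDvr
import Mathlib.FieldTheory.Galois.Infinite
import Mathlib.RingTheory.RootsOfUnity.PrimitiveRoots
import HarnessLib

/-!
# Kummer–valuation rigidity over a finite subextension of `ℚ̄_p/ℚ_p`: a Kummer class of an element of
# nonzero valuation detects the cyclotomic character of a Galois twist

Topic `Literature/NumberTheory/GaloisRepresentations`; theorems only (no definition, no named fact, no instance).
`ℚ̄_p = PadicAlgCl p` with its `p`-adic (spectral) norm; `K ⊆ ℚ̄_p` an intermediate field finite over `ℚ_[p]`;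
`G_K = K.fixingSubgroup ≤ Gal(ℚ̄_p/ℚ_p)`.

* `PadicAlgCl.exists_norm_eq_zpow` — DISCRETENESS of the valuation of `K`: there is `ϖ ∈ K`, `0 < ‖ϖ‖ < 1`, with
  `‖x‖ ∈ ‖ϖ‖^ℤ` for every `x ∈ K^×` (`𝒪_K` is a discrete valuation ring, this directory's
  `isDiscreteValuationRing_unitBall`; Serre, *Local Fields*, Ch. II §2, Prop. 3).
* `PadicAlgCl.mem_of_forall_fixing` — the fixed field of `G_K` in `ℚ̄_p` is `K` (infinite Galois theory, Mathlib
  `InfiniteGalois.fixedField_fixingSubgroup`; Neukirch, *Algebraic Number Theory*, Ch. IV (1.2)).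
* **`PadicAlgCl.kummer_valuation_rigidity_level`** / **`PadicAlgCl.kummer_valuation_rigidity`** — KUMMER THEORY WITH
  VALUATIONS (Serre, *Local Fields*, Ch. X §3 (b) with Ch. II §2; Neukirch, Ch. IV §3 / Ch. II (4.8)): let `q ∈ K`,
  `0 < ‖q‖ < 1`, `τ ∈ Gal(ℚ̄_p/ℚ_p)` with `τ⁻¹ q ∈ K`, `l ≠ 0`.  Suppose that at level `M` there are primitive `M`-th
  roots `ζ, ξ`, an `M`-th root of unity `W`, an `M`-th root `r` of `q` and integers `u, c` with `τ ζ = ζ^c` such that for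
  every `σ ∈ G_K`: `σ r = ζ^m r ∧ (τ σ τ⁻¹) r = ζ^n r ⟹ ξ^{l(u m − n)} = σ(W)/W` (a `μ_M`-valued coboundary).  Then
  `M ∣ l·(u − c)·v` for a positive integer `v` depending only on `q` (the valuation of `q`) [level form, with the unit
  `e`, `ξ = ζ^e`, made explicit]; consequently, if this holds at EVERY level `M` for compatible families `u_M`, `c_M`
  (`u_{M'} ≡ u_M`, `c_{M'} ≡ c_M (mod M)` for `M ∣ M'`), then `u_M ≡ c_M (mod M)` for all `M` [tower form] — the
  exponent `u` IS the cyclotomic character of `τ`.  Proof: `S := r^{elu} (τ⁻¹ r)^{−elc}` satisfies `σ(S)/S = σ(W)/W`,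
  so `S/W ∈ K` and `(S/W)^M = q^{elu} (τ⁻¹q)^{−elc}` has norm `‖q‖^{el(u−c)}`; discreteness gives `M ∣ v e l (u − c)`;
  apply at level `M l v` and cancel.
Used by the abc-iut cell (layer L6) to reduce the cyclotomic half (HCYC) of the binder `hgal` of [IUTchII] Prop 3.4 (i)
to the Galois half (HGAL); nothing here is specific to that use.

## References
* J.-P. Serre, *Local Fields*, GTM 67 (1979), Ch. II §2 Prop. 3, Cor. 2; Ch. X §3. [SerreLocalFields1979]
* J. Neukirch, *Algebraic Number Theory* (1999), Ch. II (4.8), Ch. IV (1.2), §3. [NeukirchANT1999]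
-/

noncomputable section

open scoped NNReal
open IsLocalRing

namespace Literature.NumberTheory.GaloisRepresentations

namespace PadicAlgCl

variable {p : ℕ} [Fact p.Prime]

/-! ### Isometry of Galois, discreteness, fixed field -/

/-- **Discreteness of the valuation of a finite subextension `K ⊆ ℚ̄_p`**: some `ϖ ∈ K` with `0 < ‖ϖ‖ < 1` has
`‖x‖ = ‖ϖ‖^n`, `n ∈ ℤ`, for every nonzero `x ∈ K` (a uniformiser of the discrete valuation ring `𝒪_K`).
[cite: SerreLocalFields1979, Ch. II §2, Prop. 3] -/
theorem exists_norm_eq_zpow (K : IntermediateField ℚ_[p] (PadicAlgCl p)) [FiniteDimensional ℚ_[p] K] :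
    ∃ ϖ : PadicAlgCl p, ϖ ∈ K ∧ 0 < ‖ϖ‖ ∧ ‖ϖ‖ < 1 ∧
      ∀ x : PadicAlgCl p, x ∈ K → x ≠ 0 → ∃ n : ℤ, ‖x‖ = ‖ϖ‖ ^ n := by
  set O := (Valued.v.comap (algebraMap K (PadicAlgCl p))).valuationSubring with hO
  haveI : IsDiscreteValuationRing O := isDiscreteValuationRing_unitBall K
  obtain ⟨ϖ₀, hϖ₀⟩ := IsDiscreteValuationRing.exists_irreducible O
  have hϖmem : ϖ₀ ∈ maximalIdeal O := by
    rw [IsLocalRing.mem_maximalIdeal, mem_nonunits_iff]; exact hϖ₀.not_isUnit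
  have hϖlt : ‖(((ϖ₀ : O) : K) : PadicAlgCl p)‖ < 1 := (mem_maximalIdeal_unitBall_iff K ϖ₀).1 hϖmem
  have hϖpos : 0 < ‖(((ϖ₀ : O) : K) : PadicAlgCl p)‖ := by
    rw [norm_pos_iff]
    intro h
    apply hϖ₀.ne_zero
    apply Subtype.ext
    exact_mod_cast h
  refine ⟨(((ϖ₀ : O) : K) : PadicAlgCl p), ((ϖ₀ : O) : K).2, hϖpos, hϖlt, fun x hxK hx0 => ?_⟩
  -- in the unit ball: `y = unit · ϖ₀^n`
  have hball : ∀ y : O, y ≠ 0 → ∃ n : ℤ, ‖(((y : O) : K) : PadicAlgCl p)‖ =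
      ‖(((ϖ₀ : O) : K) : PadicAlgCl p)‖ ^ n := by
    intro y hy
    obtain ⟨n, w, hyw⟩ := IsDiscreteValuationRing.eq_unit_mul_pow_irreducible hy hϖ₀
    refine ⟨n, ?_⟩
    have hw : ‖((((w : Oˣ) : O) : K) : PadicAlgCl p)‖ = 1 := norm_eq_one_of_isUnit K w.isUnit
    have hcoe : (((y : O) : K) : PadicAlgCl p) =
        ((((w : Oˣ) : O) : K) : PadicAlgCl p) * (((ϖ₀ : O) : K) : PadicAlgCl p) ^ n := by
      rw [hyw]; push_cast; rfl
    rw [hcoe, norm_mul, norm_pow, hw, one_mul, zpow_natCast]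
  rcases ValuationSubring.mem_or_inv_mem O ⟨x, hxK⟩ with h | h
  · have hy : (⟨⟨x, hxK⟩, h⟩ : O) ≠ 0 := by
      intro h0
      apply hx0
      have := congrArg (fun z : O => ((z : K) : PadicAlgCl p)) h0
      simpa using this
    obtain ⟨n, hn⟩ := hball _ hy
    exact ⟨n, hn⟩
  · have hy : (⟨(⟨x, hxK⟩ : K)⁻¹, h⟩ : O) ≠ 0 := by
      intro h0
      apply hx0
      have := congrArg (fun z : O => ((z : K) : PadicAlgCl p)) h0
      simpa using this
    obtain ⟨n, hn⟩ := hball _ hy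
    refine ⟨-n, ?_⟩
    have : ‖((((⟨x, hxK⟩ : K)⁻¹ : K)) : PadicAlgCl p)‖ = ‖x‖⁻¹ := by push_cast; exact norm_inv x
    rw [this] at hn
    rw [zpow_neg, ← hn, inv_inv]

/-- **The fixed field of `G_K` in `ℚ̄_p` is `K`** (`ℚ̄_p/ℚ_p` is Galois). [cite: NeukirchANT1999, Ch. IV (1.2)] -/
theorem mem_of_forall_fixing (K : IntermediateField ℚ_[p] (PadicAlgCl p)) {x : PadicAlgCl p}
    (hx : ∀ σ : PadicAlgCl p ≃ₐ[ℚ_[p]] PadicAlgCl p, σ ∈ K.fixingSubgroup → σ x = x) : x ∈ K := by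
  haveI : IsGalois ℚ_[p] (PadicAlgCl p) := {}
  have h : x ∈ IntermediateField.fixedField K.fixingSubgroup := by
    rw [IntermediateField.mem_fixedField_iff]
    intro σ hσ
    exact hx σ hσ
  rwa [InfiniteGalois.fixedField_fixingSubgroup] at h

/-! ### Kummer–valuation rigidity -/

/-- `σ r / r` is an `M`-th root of unity when `r^M ∈ K` and `σ ∈ G_K`: `σ r = ζ^m · r` for some `m < M`.
[cite: SerreLocalFields1979, Ch. X §3] -/
theorem exists_pow_mul_of_pow_mem (K : IntermediateField ℚ_[p] (PadicAlgCl p)) {M : ℕ} [NeZero M]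
    {ζ r q : PadicAlgCl p} (hζ : IsPrimitiveRoot ζ M) (hr : r ^ M = q) (hqK : q ∈ K) (hq0 : q ≠ 0)
    (σ : PadicAlgCl p ≃ₐ[ℚ_[p]] PadicAlgCl p) (hσ : σ ∈ K.fixingSubgroup) :
    ∃ m : ℕ, m < M ∧ σ r = ζ ^ m * r := by
  have hr0 : r ≠ 0 := by rintro rfl; apply hq0; rw [← hr, zero_pow (NeZero.ne M)]
  have hσq : σ q = q := (IntermediateField.mem_fixingSubgroup_iff _ _).1 hσ q hqK
  have hroot : (σ r / r) ^ M = 1 := by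
    rw [div_pow, ← map_pow, hr, hσq, div_self hq0]
  obtain ⟨m, hm, hζm⟩ := hζ.eq_pow_of_pow_eq_one hroot
  exact ⟨m, hm, by rw [hζm, div_mul_cancel₀ _ hr0]⟩

/-- **Kummer–valuation rigidity, level form.** [cite: SerreLocalFields1979, Ch. X §3] -/
theorem kummer_valuation_rigidity_level (K : IntermediateField ℚ_[p] (PadicAlgCl p))
    {q ϖ : PadicAlgCl p} (hqK : q ∈ K) (hq0 : q ≠ 0) (hϖ0 : 0 < ‖ϖ‖) (hϖ1 : ‖ϖ‖ < 1) {v : ℤ}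
    (hv : ‖q‖ = ‖ϖ‖ ^ v) (hdisc : ∀ x : PadicAlgCl p, x ∈ K → x ≠ 0 → ∃ n : ℤ, ‖x‖ = ‖ϖ‖ ^ n)
    (τ : PadicAlgCl p ≃ₐ[ℚ_[p]] PadicAlgCl p) (hτq : τ.symm q ∈ K) (l : ℕ) {M : ℕ} [NeZero M]
    {ζ ξ r W : PadicAlgCl p} (hζ : IsPrimitiveRoot ζ M) (hξ : IsPrimitiveRoot ξ M) (hW : W ^ M = 1)
    (hr : r ^ M = q) {u c : ℤ} (hc : τ ζ = ζ ^ c)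
    (hrel : ∀ σ : PadicAlgCl p ≃ₐ[ℚ_[p]] PadicAlgCl p, σ ∈ K.fixingSubgroup →
      ∀ m n : ℤ, σ r = ζ ^ m * r → (τ * σ * τ⁻¹) r = ζ ^ n * r → ξ ^ ((l : ℤ) * (u * m - n)) = σ W / W) :
    ∃ e : ℕ, e.Coprime M ∧ (M : ℤ) ∣ v * e * l * (u - c) := by
  -- `ξ = ζ^e` with `e` coprime to `M`
  obtain ⟨e, -, hecop, hξe⟩ := (hζ.isPrimitiveRoot_iff).1 hξ
  refine ⟨e, hecop, ?_⟩
  have hζ0 : ζ ≠ 0 := hζ.ne_zero (NeZero.ne M)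
  have hr0 : r ≠ 0 := by rintro rfl; apply hq0; rw [← hr, zero_pow (NeZero.ne M)]
  set r' : PadicAlgCl p := τ.symm r with hr'
  have hr'M : r' ^ M = τ.symm q := by rw [hr', ← map_pow, hr]
  have hq'0 : τ.symm q ≠ 0 := by rw [ne_eq, map_eq_zero_iff _ τ.symm.injective]; exact hq0
  have hr'0 : r' ≠ 0 := by rintro h; apply hq'0; rw [← hr'M, h, zero_pow (NeZero.ne M)]
  have hW0 : W ≠ 0 := by rintro rfl; rw [zero_pow (NeZero.ne M)] at hW; exact zero_ne_one hW
  -- the element `S := r^{elu} · r'^{-elc}`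
  set a : ℤ := (e : ℤ) * l * u with ha
  set b : ℤ := (e : ℤ) * l * c with hb
  set S : PadicAlgCl p := r ^ a * r' ^ (-b) with hS
  have hS0 : S ≠ 0 := mul_ne_zero (zpow_ne_zero _ hr0) (zpow_ne_zero _ hr'0)
  -- `σ(S)/S = σ(W)/W` for `σ ∈ G_K`
  have hSW : ∀ σ : PadicAlgCl p ≃ₐ[ℚ_[p]] PadicAlgCl p, σ ∈ K.fixingSubgroup → σ (S / W) = S / W := by
    intro σ hσ
    obtain ⟨m, -, hm⟩ := exists_pow_mul_of_pow_mem K hζ hr hqK hq0 σ hσ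
    obtain ⟨n', -, hn'⟩ := exists_pow_mul_of_pow_mem K hζ hr'M hτq hq'0 σ hσ
    -- `(τ σ τ⁻¹) r = ζ^{c n'} r`
    have hconj : (τ * σ * τ⁻¹) r = ζ ^ (c * n') * r := by
      rw [AlgEquiv.mul_apply, AlgEquiv.mul_apply, AlgEquiv.aut_inv, ← hr', hn', map_mul, map_pow, hc,
        ← zpow_natCast, ← zpow_mul, hr', AlgEquiv.apply_symm_apply]
    have hm' : σ r = ζ ^ (m : ℤ) * r := by rw [zpow_natCast, hm]
    have key := hrel σ hσ m (c * n') hm' hconj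
    -- compute `σ S / S`
    have hσS : σ S = ζ ^ ((m : ℤ) * a + (n' : ℤ) * -b) * S := by
      rw [hS, map_mul, map_zpow₀, map_zpow₀, hm, hn', mul_zpow, mul_zpow, ← zpow_natCast ζ m,
        ← zpow_natCast ζ n', ← zpow_mul, ← zpow_mul, zpow_add₀ hζ0]
      ring
    have hexp : (l : ℤ) * (u * m - c * n') * e = (m : ℤ) * a + (n' : ℤ) * -b := by rw [ha, hb]; ring
    have hζpow : ζ ^ ((m : ℤ) * a + (n' : ℤ) * -b) = σ W / W := by
      rw [← hexp, zpow_mul, ← key, ← hξe, ← zpow_natCast, ← zpow_mul, ← zpow_mul, mul_comm]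
    have hσW : σ W ≠ 0 := by rw [ne_eq, map_eq_zero_iff _ σ.injective]; exact hW0
    rw [map_div₀, hσS, hζpow]
    field_simp [hσW]
  -- hence `S / W ∈ K` and `(S/W)^M = q^a (τ⁻¹ q)^{-b}`
  have hmem : S / W ∈ K := mem_of_forall_fixing K hSW
  have hswap : ∀ (x : PadicAlgCl p) (i : ℤ) (j : ℕ), (x ^ i) ^ j = (x ^ j) ^ i := fun x i j => by
    rw [← zpow_natCast, ← zpow_mul, mul_comm, zpow_mul, zpow_natCast]
  have hpow : (S / W) ^ M = q ^ a * (τ.symm q) ^ (-b) := by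
    rw [div_pow, hW, div_one, hS, mul_pow, hswap, hswap, hr, hr'M]
  -- norms: `‖S/W‖^M = ‖q‖^{a-b}`; discreteness `‖S/W‖ = ‖ϖ‖^k` ⇒ `k M = v (a - b)`
  obtain ⟨k, hk⟩ := hdisc (S / W) hmem (div_ne_zero hS0 hW0)
  -- `ℚ_p`-automorphisms are isometries (the norm of `ℚ̄_p` is the spectral norm; also landed as
  -- `Literature.NumberTheory.LFunctions.Dwork.norm_algEquiv_apply`, not imported to keep this chain light)
  have hτn : ‖τ.symm q‖ = ‖q‖ := by
    rw [← _root_.PadicAlgCl.spectralNorm_eq, ← _root_.PadicAlgCl.spectralNorm_eq, ← spectralNorm_eq_of_equiv]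
  have hϖne : ‖ϖ‖ ≠ 0 := hϖ0.ne'
  have eq1 : ‖(S / W) ^ M‖ = ‖ϖ‖ ^ (k * (M : ℤ)) := by
    rw [norm_pow, hk, ← zpow_natCast, ← zpow_mul]
  have eq2 : ‖q ^ a * (τ.symm q) ^ (-b)‖ = ‖ϖ‖ ^ (v * (a - b)) := by
    rw [norm_mul, norm_zpow, norm_zpow, hτn, hv, ← zpow_mul, ← zpow_mul, ← zpow_add₀ hϖne]
    congr 1; ring
  have h1 : ‖ϖ‖ ^ (k * (M : ℤ)) = ‖ϖ‖ ^ (v * (a - b)) := by rw [← eq1, ← eq2, hpow]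
  have h2 : k * (M : ℤ) = v * (a - b) := (zpow_right_strictAnti₀ hϖ0 hϖ1).injective h1
  refine ⟨k, ?_⟩
  rw [mul_comm (M : ℤ) k, h2, ha, hb]; ring

/-- **Kummer–valuation rigidity, tower form**: if the level relation holds at every level `M ≥ 1` for compatible
families `u_M`, `c_M`, then `u_M ≡ c_M (mod M)` — the exponent `u` is the cyclotomic character of `τ`.
[cite: SerreLocalFields1979, Ch. X §3] -/
theorem kummer_valuation_rigidity (K : IntermediateField ℚ_[p] (PadicAlgCl p)) [FiniteDimensional ℚ_[p] K]
    {q : PadicAlgCl p} (hqK : q ∈ K) (hq0 : q ≠ 0) (hq1 : ‖q‖ < 1)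
    (τ : PadicAlgCl p ≃ₐ[ℚ_[p]] PadicAlgCl p) (hτq : τ.symm q ∈ K) {l : ℕ} (hl : l ≠ 0)
    (u c : ℕ+ → ℤ) (hu : ∀ M M' : ℕ+, (M : ℕ) ∣ M' → u M' ≡ u M [ZMOD M])
    (hcc : ∀ M M' : ℕ+, (M : ℕ) ∣ M' → c M' ≡ c M [ZMOD M])
    (hrel : ∀ M : ℕ+, ∃ (ζ ξ r W : PadicAlgCl p), IsPrimitiveRoot ζ M ∧ IsPrimitiveRoot ξ M ∧ W ^ (M : ℕ) = 1 ∧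
      r ^ (M : ℕ) = q ∧ τ ζ = ζ ^ (c M) ∧
      ∀ σ : PadicAlgCl p ≃ₐ[ℚ_[p]] PadicAlgCl p, σ ∈ K.fixingSubgroup →
        ∀ m n : ℤ, σ r = ζ ^ m * r → (τ * σ * τ⁻¹) r = ζ ^ n * r → ξ ^ ((l : ℤ) * (u M * m - n)) = σ W / W) :
    ∀ M : ℕ+, u M ≡ c M [ZMOD M] := by
  obtain ⟨ϖ, -, hϖ0, hϖ1, hdisc⟩ := exists_norm_eq_zpow K
  obtain ⟨v, hv⟩ := hdisc q hqK hq0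
  -- `v > 0` since `‖q‖ < 1`
  have hvpos : 0 < v := by
    by_contra hle
    have h1 : (1 : ℝ) ≤ ‖ϖ‖ ^ v := one_le_zpow_of_nonpos₀ hϖ0 hϖ1.le (not_lt.1 hle)
    rw [← hv] at h1
    exact absurd hq1 (not_lt.2 h1)
  intro M
  -- apply the level form at level `M₁ := M · l · v`
  lift v to ℕ using hvpos.le
  have hv0 : (v : ℕ) ≠ 0 := by exact_mod_cast hvpos.ne'
  set M₁ : ℕ+ := ⟨M * l * v, Nat.mul_pos (Nat.mul_pos M.pos (Nat.pos_of_ne_zero hl)) (Nat.pos_of_ne_zero hv0)⟩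
    with hM₁
  have hM₁coe : ((M₁ : ℕ+) : ℕ) = M * l * v := by rw [hM₁, PNat.mk_coe]
  obtain ⟨ζ, ξ, r, W, hζ, hξ, hW, hr, hc, hrelM⟩ := hrel M₁
  haveI : NeZero ((M₁ : ℕ+) : ℕ) := ⟨M₁.ne_zero⟩
  obtain ⟨e, hecop, hdvd⟩ := kummer_valuation_rigidity_level K hqK hq0 hϖ0 hϖ1 hv hdisc τ hτq l hζ hξ hW hr hc
    hrelM
  -- `M l v ∣ v e l (u₁ - c₁)` ⇒ `M ∣ e (u₁ - c₁)` ⇒ `M ∣ u₁ - c₁`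
  have hM₁val : ((M₁ : ℕ+) : ℤ) = (M : ℤ) * ((l : ℤ) * (v : ℤ)) := by rw [hM₁coe]; push_cast; ring
  rw [hM₁val] at hdvd
  have hlv0 : ((l : ℤ) * (v : ℤ)) ≠ 0 := by exact_mod_cast mul_ne_zero hl hv0
  have hdvd' : (M : ℤ) ∣ (u M₁ - c M₁) * (e : ℤ) := by
    have : (M : ℤ) * ((l : ℤ) * (v : ℤ)) ∣ ((u M₁ - c M₁) * (e : ℤ)) * ((l : ℤ) * (v : ℤ)) := by
      convert hdvd using 1; ring
    exact (mul_dvd_mul_iff_right hlv0).1 this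
  have hMdvd : ((M : ℕ+) : ℕ) ∣ (M₁ : ℕ+) := ⟨l * v, by rw [hM₁coe, Nat.mul_assoc]⟩
  have hcopM : IsCoprime (M : ℤ) (e : ℤ) := by
    have h2 : Nat.Coprime e M := Nat.Coprime.coprime_dvd_right hMdvd hecop
    exact (Nat.isCoprime_iff_coprime.2 h2).symm
  have hdvdM : (M : ℤ) ∣ u M₁ - c M₁ := hcopM.dvd_of_dvd_mul_right hdvd'
  have h3 : u M₁ ≡ c M₁ [ZMOD M] := Int.modEq_iff_dvd.2 (by rw [← neg_sub]; exact hdvdM.neg_right)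
  exact ((hu M M₁ hMdvd).symm.trans h3).trans (hcc M M₁ hMdvd)

end PadicAlgCl

end Literature.NumberTheory.GaloisRepresentations

end
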